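import Summits.ABC.ABC.Theorems.TwistAmplificationSharpModerateLawDeepRegimeCalibrationLemmas
import Summits.ABC.ABC.Theorems.TwistAmplificationSharpModerateLawCuspDispersionTwDefs
import Summits.ABC.ABC.Theorems.TwistAmplificationFreyAmplification

/-!
# Crux `TwistAmplification.SharpModerateLaw` (stmt-ABC-1975), line `deep-moduli-cusp-dispersion`:
the deep-regime law alone implies the summit — support lemmas

Support file 1/2 of the summit calibration `abc_of_lawOn_deepRegimeTw_of_facts` (file
`TwistAmplificationSharpModerateLawAbcOfDeepRegimeLaw.lean`, registered calibration sub-goal a2 of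
stmt-ABC-1975): the conclusion `LawOn DeepRegimeTw` of the line's hardest stub `stub_deepRegime` — the cusp
counting law C⁺′ on the twist-aware DEEP regime — ALREADY implies `_root_.ABC`, by feeding it the prime
quadratic twists `x = (d²c₄, d³c₆)` of the Frey pairs `freyPair a b = (c₄, c₆)` of abc triples and invoking
the landed arithmetic Frey–twist amplification `Summit.ABC.ABC.Theorems.FreyAmplification_proof` at
`κ = 4`, `σ = 12`.  The two arithmetic facts about twisted Frey pairs (injectivity a0, invariants a1) are
hypotheses of a2; this file supplies the bookkeeping around them (adapted from the landed transfer
`DeepModuli.stub_cuspTransfer`, file `…DeepModuliCuspTransfer.lean`, with `κ = 4`, `σ = 12`):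
* §1 the shells: budget `X_j = min(X', 2^{(j+1)/4})`, level `Y_j = 2^{j+1} − 1`, the cone conditions and
  the uniform per-shell bound `3C₀X'^{ε/2}X'^{1−4/6}` (`shell_bound`, via `shell_main_le` at `κ = 4`);
* §2 the window arithmetic `N⁴ ≤ (cd)⁶ ≤ N¹²`, `d ≤ c³` (`window_pow`), the finite box of exceptional data
  (`bad_box`, `card_bad_le`) and the thick-tube inequality (`thick_arith`);
* §3 membership of the twisted Frey pair in the deep-regime set at any window `M ≤ Y < 2M`, `N* ≤ X₀`
  (`twistedFreyPair_mem_deepRegimeTw`, registered sub-goal, last theorem).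
-/

noncomputable section

set_option linter.dupNamespace false

namespace Summit.ABC.ABC.Theorems.SharpModerateLaw.CuspDispersion

open Literature.NumberTheory.DiophantineGeometry (IsABCTriple rad)

/-! ## 1. Shells: budget, level, cone, per-shell bound -/

/-- `A_j = 2^{(j+1)/4}` satisfies `A_j⁴ = 2·2^j` (real exponent `4`). -/
theorem budget_rpow_four (j : ℕ) :
    ((2 : ℝ) ^ (((j + 1 : ℕ) : ℝ) / 4)) ^ (4 : ℝ) = 2 * (2 : ℝ) ^ j := by
  rw [← Real.rpow_mul (by norm_num), div_mul_cancel₀ _ (by norm_num : (4 : ℝ) ≠ 0), Real.rpow_natCast,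
    pow_succ, mul_comm]

/-- `A_j⁴ = 2·2^j` with a natural exponent. -/
theorem budget_pow_four (j : ℕ) :
    ((2 : ℝ) ^ (((j + 1 : ℕ) : ℝ) / 4)) ^ 4 = 2 * (2 : ℝ) ^ j := by
  rw [← budget_rpow_four j, ← Real.rpow_natCast _ 4]
  norm_num

/-- If `n⁴ < 2·2^j` then `n ≤ A_j = 2^{(j+1)/4}`. -/
theorem le_budget_of_pow_four_lt {n : ℝ} {j : ℕ} (h : n ^ 4 < 2 * (2 : ℝ) ^ j) :
    n ≤ (2 : ℝ) ^ (((j + 1 : ℕ) : ℝ) / 4) := by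
  by_contra hlt
  push Not at hlt
  have hA : 0 ≤ (2 : ℝ) ^ (((j + 1 : ℕ) : ℝ) / 4) := Real.rpow_nonneg (by norm_num) _
  have h4 := pow_lt_pow_left₀ hlt hA (by norm_num : (4 : ℕ) ≠ 0)
  rw [budget_pow_four] at h4
  linarith

/-- The dyadic level of a positive integer `M`: with `j = ⌊log₂ M⌋` and `Y_j = 2·2^j − 1`,
`M ≤ Y_j < 2M` (adapted from `…DeepModuliCuspTransfer`). -/
theorem level_window {M : ℕ} (hM0 : M ≠ 0) :
    (M : ℝ) ≤ 2 * (2 : ℝ) ^ Nat.log 2 M - 1 ∧ 2 * (2 : ℝ) ^ Nat.log 2 M - 1 < 2 * (M : ℝ) := by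
  have hlow : (2 : ℝ) ^ Nat.log 2 M ≤ (M : ℝ) := by exact_mod_cast Nat.pow_log_le_self 2 hM0
  have hupp : (M : ℝ) + 1 ≤ 2 * (2 : ℝ) ^ Nat.log 2 M := by
    have h := Nat.lt_pow_succ_log_self (b := 2) (by norm_num) M
    have h' : ((M + 1 : ℕ) : ℝ) ≤ ((2 ^ (Nat.log 2 M + 1) : ℕ) : ℝ) := by exact_mod_cast h
    push_cast at h'
    simpa [pow_succ, mul_comm] using h'
  constructor <;> linarith

/-- The shell range: `j ≤ J = ⌊log₂ ⌊X'^{12}⌋⌋` gives `2^j ≤ X'^{12}` (`X' ≥ 1`). -/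
theorem two_pow_le_of_le_log {X' : ℝ} (hX'1 : 1 ≤ X') {j : ℕ} (hj : j ≤ Nat.log 2 ⌊X' ^ (12 : ℝ)⌋₊) :
    (2 : ℝ) ^ j ≤ X' ^ (12 : ℝ) := by
  have hfl0 : ⌊X' ^ (12 : ℝ)⌋₊ ≠ 0 := by
    have h1 : (1 : ℝ) ≤ X' ^ (12 : ℝ) := Real.one_le_rpow hX'1 (by norm_num)
    have : 1 ≤ ⌊X' ^ (12 : ℝ)⌋₊ := Nat.le_floor (by exact_mod_cast h1)
    omega
  have hA : ((2 ^ Nat.log 2 ⌊X' ^ (12 : ℝ)⌋₊ : ℕ) : ℝ) ≤ (⌊X' ^ (12 : ℝ)⌋₊ : ℝ) := by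
    exact_mod_cast Nat.pow_log_le_self 2 hfl0
  push_cast at hA
  calc (2 : ℝ) ^ j ≤ (2 : ℝ) ^ Nat.log 2 ⌊X' ^ (12 : ℝ)⌋₊ := pow_le_pow_right₀ (by norm_num) hj
    _ ≤ ⌊X' ^ (12 : ℝ)⌋₊ := hA
    _ ≤ X' ^ (12 : ℝ) := Nat.floor_le (by positivity)

/-- The level `M < X'^{12}` has shell index `⌊log₂ M⌋ ≤ J = ⌊log₂ ⌊X'^{12}⌋⌋`. -/
theorem log_le_of_lt_rpow {M : ℕ} {X' : ℝ} (hM : (M : ℝ) ≤ X' ^ (12 : ℝ)) :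
    Nat.log 2 M ≤ Nat.log 2 ⌊X' ^ (12 : ℝ)⌋₊ :=
  Nat.log_mono_right (Nat.le_floor hM)

/-- **Per-shell bound** (adapted from `…DeepModuliCuspTransfer`, `κ = 4`, law at `σ = 13`): at the scales
`X_j = min(X', 2^{(j+1)/4})`, `Y_j = 2·2^j − 1` with `2^j ≤ X'^{12}`, `X' ≥ 2`, the two cone conditions hold and a
family `D` obeying the law with exponent `ε/2` and constant `C₀ ≥ 0` has `#D(X_j, Y_j) ≤ 3C₀·X'^{ε/2}·X'^{1−4/6}`. -/
theorem shell_bound {C₀ ε X' : ℝ} {D : ℝ → ℝ → Set (ℤ × ℤ)} (hC₀ : 0 ≤ C₀) (hε : 0 < ε) (hX'2 : 2 ≤ X')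
    (hC : ∀ X₀ Y : ℝ, 1 ≤ X₀ → 1 ≤ Y → X₀ ^ 3 ≤ 8 * Y → Y ≤ X₀ ^ (13 : ℝ) →
      ((D X₀ Y).ncard : ℝ) ≤ C₀ * X₀ ^ (ε / 2) * (X₀ * Y ^ (-(1 / 6 : ℝ)) + 1))
    {j : ℕ} (hj : (2 : ℝ) ^ j ≤ X' ^ (12 : ℝ)) :
    ((D (min X' ((2 : ℝ) ^ (((j + 1 : ℕ) : ℝ) / 4))) (2 * (2 : ℝ) ^ j - 1)).ncard : ℝ) ≤
      3 * C₀ * X' ^ (ε / 2) * X' ^ (1 - 4 / 6 : ℝ) := by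
  have hX'1 : 1 ≤ X' := by linarith
  have hX'0 : 0 < X' := by linarith
  have hε2 : 0 < ε / 2 := by positivity
  set A : ℝ := (2 : ℝ) ^ (((j + 1 : ℕ) : ℝ) / 4) with hA
  set Xj : ℝ := min X' A with hXj
  set Yj : ℝ := 2 * (2 : ℝ) ^ j - 1 with hYj
  have h2j1 : (1 : ℝ) ≤ (2 : ℝ) ^ j := one_le_pow₀ (by norm_num)
  have hYj1 : 1 ≤ Yj := by rw [hYj]; linarith
  have hYj2 : (2 : ℝ) ^ j ≤ Yj := by rw [hYj]; linarith
  have hYj3 : Yj < 2 * (2 : ℝ) ^ j := by rw [hYj]; linarith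
  have hA1 : 1 ≤ A := Real.one_le_rpow (by norm_num) (by positivity)
  have hA4 : A ^ (4 : ℝ) = 2 * (2 : ℝ) ^ j := budget_rpow_four j
  have hXj1 : 1 ≤ Xj := le_min hX'1 hA1
  have hXjX : Xj ≤ X' := min_le_left _ _
  have hXjA : Xj ≤ A := min_le_right _ _
  have hXj0 : 0 ≤ Xj := by linarith
  have hcone1 : Xj ^ 3 ≤ 8 * Yj := by
    calc Xj ^ 3 = Xj ^ ((3 : ℕ) : ℝ) := (Real.rpow_natCast _ 3).symm
      _ ≤ Xj ^ (4 : ℝ) := Real.rpow_le_rpow_of_exponent_le hXj1 (by norm_num)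
      _ ≤ A ^ (4 : ℝ) := Real.rpow_le_rpow hXj0 hXjA (by norm_num)
      _ = 2 * (2 : ℝ) ^ j := hA4
      _ ≤ 8 * Yj := by linarith
  have hcone2 : Yj ≤ Xj ^ (13 : ℝ) := by
    rcases min_cases X' A with ⟨hmin, -⟩ | ⟨hmin, -⟩
    · rw [show Xj = X' from hmin, show (13 : ℝ) = 12 + 1 by norm_num, Real.rpow_add hX'0, Real.rpow_one]
      calc Yj ≤ 2 * (2 : ℝ) ^ j := hYj3.le
        _ ≤ X' ^ (12 : ℝ) * 2 := by linarith
        _ ≤ X' ^ (12 : ℝ) * X' := mul_le_mul_of_nonneg_left hX'2 (by positivity)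
    · rw [show Xj = A from hmin]
      calc Yj ≤ 2 * (2 : ℝ) ^ j := hYj3.le
        _ = A ^ (4 : ℝ) := hA4.symm
        _ ≤ A ^ (13 : ℝ) := Real.rpow_le_rpow_of_exponent_le hA1 (by norm_num)
  have hb := hC Xj Yj hXj1 hYj1 hcone1 hcone2
  have hloss : Xj ^ (ε / 2) ≤ X' ^ (ε / 2) := Real.rpow_le_rpow hXj0 hXjX hε2.le
  have hmain : Xj * Yj ^ (-(1 / 6 : ℝ)) + 1 ≤ 3 * X' ^ (1 - 4 / 6 : ℝ) := by
    have h6 : Yj ^ (-(1 / 6 : ℝ)) ≤ ((2 : ℝ) ^ j) ^ (-(1 / 6 : ℝ)) :=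
      Real.rpow_le_rpow_of_nonpos (by positivity) hYj2 (by norm_num)
    have h7 : Xj * Yj ^ (-(1 / 6 : ℝ)) ≤ Xj * ((2 : ℝ) ^ j) ^ (-(1 / 6 : ℝ)) :=
      mul_le_mul_of_nonneg_left h6 hXj0
    have h8 : Xj * ((2 : ℝ) ^ j) ^ (-(1 / 6 : ℝ)) ≤ 2 * X' ^ (1 - 4 / 6 : ℝ) :=
      shell_main_le (κ := 4) (by norm_num) (by norm_num) hX'1 j
    have hXpow1 : 1 ≤ X' ^ (1 - 4 / 6 : ℝ) := Real.one_le_rpow hX'1 (by norm_num)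
    linarith
  have hnn1 : 0 ≤ Xj * Yj ^ (-(1 / 6 : ℝ)) + 1 :=
    add_nonneg (mul_nonneg hXj0 (Real.rpow_nonneg (by linarith) _)) zero_le_one
  calc ((D Xj Yj).ncard : ℝ) ≤ C₀ * Xj ^ (ε / 2) * (Xj * Yj ^ (-(1 / 6 : ℝ)) + 1) := hb
    _ = C₀ * (Xj ^ (ε / 2) * (Xj * Yj ^ (-(1 / 6 : ℝ)) + 1)) := by ring
    _ ≤ C₀ * (X' ^ (ε / 2) * (3 * X' ^ (1 - 4 / 6 : ℝ))) := by
        apply mul_le_mul_of_nonneg_left _ hC₀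
        exact mul_le_mul hloss hmain hnn1 (by positivity)
    _ = 3 * C₀ * X' ^ (ε / 2) * X' ^ (1 - 4 / 6 : ℝ) := by ring

/-! ## 2. Window arithmetic, the exceptional box, the thick tube -/

/-- From the logarithmic window `4 log N ≤ 6 log(cd) ≤ 12 log N`, `N = r·d²` (`r, c, d ≥ 1`):
`N⁴ ≤ (cd)⁶ ≤ N¹²` and `d ≤ c³` (as `d⁸ ≤ N⁴ ≤ c⁶d⁶`). -/
theorem window_pow {r c d : ℕ} (hr : 0 < r) (hc : 0 < c) (hd : 0 < d)
    (hw1 : 4 * Real.log ((r : ℝ) * (d : ℝ) ^ 2) ≤ 6 * Real.log ((c : ℝ) * (d : ℝ)))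
    (hw2 : 6 * Real.log ((c : ℝ) * (d : ℝ)) ≤ 12 * Real.log ((r : ℝ) * (d : ℝ) ^ 2)) :
    ((r : ℝ) * (d : ℝ) ^ 2) ^ 4 ≤ ((c : ℝ) * d) ^ 6 ∧ ((c : ℝ) * d) ^ 6 ≤ ((r : ℝ) * (d : ℝ) ^ 2) ^ 12 ∧
      d ≤ c ^ 3 := by
  have hr1 : (1 : ℝ) ≤ r := by exact_mod_cast hr
  have hc1 : (1 : ℝ) ≤ c := by exact_mod_cast hc
  have hd1 : (1 : ℝ) ≤ d := by exact_mod_cast hd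
  have hN0 : 0 < (r : ℝ) * (d : ℝ) ^ 2 := by positivity
  have hcd0 : 0 < (c : ℝ) * d := by positivity
  have h1 : ((r : ℝ) * (d : ℝ) ^ 2) ^ 4 ≤ ((c : ℝ) * d) ^ 6 := by
    rw [← Real.log_le_log_iff (by positivity) (by positivity), Real.log_pow, Real.log_pow]
    push_cast
    linarith
  have h2 : ((c : ℝ) * d) ^ 6 ≤ ((r : ℝ) * (d : ℝ) ^ 2) ^ 12 := by
    rw [← Real.log_le_log_iff (by positivity) (by positivity), Real.log_pow, Real.log_pow]
    push_cast
    linarith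
  refine ⟨h1, h2, ?_⟩
  have h3 : (d : ℝ) ^ 2 * (d : ℝ) ^ 6 ≤ ((c : ℝ) ^ 3) ^ 2 * (d : ℝ) ^ 6 := by
    have h4 : ((d : ℝ) ^ 2) ^ 4 ≤ ((r : ℝ) * (d : ℝ) ^ 2) ^ 4 :=
      pow_le_pow_left₀ (by positivity) (by nlinarith [sq_nonneg (d : ℝ)]) 4
    calc (d : ℝ) ^ 2 * (d : ℝ) ^ 6 = ((d : ℝ) ^ 2) ^ 4 := by ring
      _ ≤ ((c : ℝ) * d) ^ 6 := h4.trans h1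
      _ = ((c : ℝ) ^ 3) ^ 2 * (d : ℝ) ^ 6 := by ring
  have h5 : (d : ℝ) ^ 2 ≤ ((c : ℝ) ^ 3) ^ 2 := le_of_mul_le_mul_right h3 (by positivity)
  have h6 : (d : ℝ) ≤ (c : ℝ) ^ 3 := le_of_pow_le_pow_left₀ two_ne_zero (by positivity) h5
  exact_mod_cast h6

/-- The exceptional data are boxed: if `a = b` (then `a = b = 1` by coprimality) or `(ab)² < 363(a + b)`, then
`a, b < 726`, `a + b < 1451` and `d ≤ (a + b)³ < 1450³ + 1`. -/
theorem bad_box {a b d : ℕ} (ha : 0 < a) (hb : 0 < b) (hcop : Nat.Coprime a b) (hdc : d ≤ (a + b) ^ 3)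
    (hbad : ¬ (a ≠ b ∧ 363 * (a + b) ≤ (a * b) ^ 2)) :
    a < 726 ∧ b < 726 ∧ a + b < 1451 ∧ d < 1450 ^ 3 + 1 := by
  have hab : a < 726 ∧ b < 726 := by
    by_cases heq : a = b
    · subst heq
      have h1 : a = 1 := by simpa [Nat.Coprime] using hcop
      subst h1
      norm_num
    · have hlt : (a * b) ^ 2 < 363 * (a + b) := by
        by_contra h
        exact hbad ⟨heq, not_lt.mp h⟩
      have ha1 : 1 ≤ a := ha
      have hb1 : 1 ≤ b := hb
      rcases le_total b a with hba | hab
      · have ha' : a < 726 := by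
          by_contra h
          push Not at h
          have : 363 * (a + b) ≤ (a * b) ^ 2 :=
            calc 363 * (a + b) ≤ 363 * (a + a) := Nat.mul_le_mul le_rfl (Nat.add_le_add_left hba a)
              _ = 726 * a := by ring
              _ ≤ a * a := Nat.mul_le_mul h le_rfl
              _ = (a * 1) ^ 2 := by ring
              _ ≤ (a * b) ^ 2 := Nat.pow_le_pow_left (Nat.mul_le_mul le_rfl hb1) 2
          exact absurd this (not_le.mpr hlt)
        exact ⟨ha', lt_of_le_of_lt hba ha'⟩
      · have hb' : b < 726 := by
          by_contra h
          push Not at h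
          have : 363 * (a + b) ≤ (a * b) ^ 2 :=
            calc 363 * (a + b) ≤ 363 * (b + b) := Nat.mul_le_mul le_rfl (Nat.add_le_add_right hab b)
              _ = 726 * b := by ring
              _ ≤ b * b := Nat.mul_le_mul h le_rfl
              _ = (1 * b) ^ 2 := by ring
              _ ≤ (a * b) ^ 2 := Nat.pow_le_pow_left (Nat.mul_le_mul ha1 le_rfl) 2
          exact absurd this (not_le.mpr hlt)
        exact ⟨lt_of_le_of_lt hab hb', hb'⟩
  obtain ⟨ha', hb'⟩ := hab
  refine ⟨ha', hb', by omega, ?_⟩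
  have hc : a + b ≤ 1450 := by omega
  calc d ≤ (a + b) ^ 3 := hdc
    _ ≤ 1450 ^ 3 := Nat.pow_le_pow_left hc 3
    _ < 1450 ^ 3 + 1 := Nat.lt_succ_self _

/-- **The exceptional data are `O(1)`**: window data `(a, b, c, d)` (at `κ = 4`, `σ = 12`) with `a = b` or
`(ab)² < 363c` lie in a fixed finite box (`d ≤ c³` by `window_pow`, then `bad_box`). -/
theorem card_bad_le {X : ℝ} (S : Finset (ℕ × ℕ × ℕ × ℕ))
    (hS : ∀ t ∈ S, (IsABCTriple t.1 t.2.1 t.2.2.1 ∧ (t.2.2.2 = 1 ∨ Nat.Prime t.2.2.2) ∧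
        Nat.Coprime t.2.2.2 (t.1 * t.2.1 * t.2.2.1) ∧
        ((rad t.1 t.2.1 t.2.2.1 : ℕ) : ℝ) * (t.2.2.2 : ℝ) ^ 2 ≤ X ∧
        4 * Real.log (((rad t.1 t.2.1 t.2.2.1 : ℕ) : ℝ) * (t.2.2.2 : ℝ) ^ 2) ≤
          6 * Real.log ((t.2.2.1 : ℝ) * (t.2.2.2 : ℝ)) ∧
        6 * Real.log ((t.2.2.1 : ℝ) * (t.2.2.2 : ℝ)) ≤
          12 * Real.log (((rad t.1 t.2.1 t.2.2.1 : ℕ) : ℝ) * (t.2.2.2 : ℝ) ^ 2)) ∧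
        ¬ (t.1 ≠ t.2.1 ∧ 363 * t.2.2.1 ≤ (t.1 * t.2.1) ^ 2)) :
    S.card ≤ 726 * (726 * (1451 * (1450 ^ 3 + 1))) := by
  -- (the box is proved on the components first: no `cases`/`subst` in front of a `Finset.range` goal)
  have key : ∀ t ∈ S, t.1 < 726 ∧ t.2.1 < 726 ∧ t.2.2.1 < 1451 ∧ t.2.2.2 < 1450 ^ 3 + 1 := by
    rintro ⟨a, b, c, d⟩ ht
    obtain ⟨⟨⟨ha, hb, hsum, hcop⟩, hd, -, -, hw1, hw2⟩, hbad⟩ := hS _ ht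
    dsimp only at ha hb hsum hcop hd hw1 hw2 hbad ⊢
    subst hsum
    have hr : 0 < rad a b (a + b) := by
      rw [Literature.NumberTheory.DiophantineGeometry.rad_def]; exact Nat.radical_pos _
    have hd0 : 0 < d := hd.elim (fun h => h ▸ one_pos) (fun h => h.pos)
    obtain ⟨-, -, hdc⟩ := window_pow hr (by omega) hd0 hw1 hw2
    exact bad_box ha hb hcop hdc hbad
  have hsub : S ⊆ Finset.range 726 ×ˢ (Finset.range 726 ×ˢ (Finset.range 1451 ×ˢ Finset.range (1450 ^ 3 + 1))) := by
    intro t ht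
    have h := key t ht
    simp only [Finset.mem_product, Finset.mem_range]
    exact h
  calc S.card ≤ _ := Finset.card_le_card hsub
    _ = 726 * (726 * (1451 * (1450 ^ 3 + 1))) := by
        simp only [Finset.card_product, Finset.card_range]

/-- **Thick-tube arithmetic**: with `P = ab`, `c = a + b`, `(ab)² ≥ 363c`, a level `Y < 2M`, `M < 4096(cd)⁶` and
a twist divisor `d' ≤ 4d`, the tube inequality `|c₄³ − c₆²| = 27648·(abc)²d⁶ ≤ 1728·Y^{1/2}·d'³` fails
(`(abc)²d³ ≤ 4√Y`, squared: `(ab)⁴c⁴ < 131072c⁶ ≤ 363²c⁶`). -/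
theorem thick_arith {P c d d' Y M : ℝ} (hc : 1 ≤ c) (hd : 1 ≤ d) (hd'0 : 0 ≤ d') (hd' : d' ≤ 4 * d)
    (hP : 363 * c ≤ P ^ 2) (hY0 : 0 ≤ Y) (hYM : Y < 2 * M) (hM : M < 4096 * (c * d) ^ 6) :
    ¬ (27648 * (P * c) ^ 2 * d ^ 6 ≤ 1728 * Y ^ (1 / 2 : ℝ) * d' ^ 3) := by
  intro h
  have hs0 : 0 ≤ Y ^ (1 / 2 : ℝ) := Real.rpow_nonneg hY0 _
  have hs2 : (Y ^ (1 / 2 : ℝ)) ^ 2 = Y := by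
    rw [← Real.rpow_natCast (Y ^ (1 / 2 : ℝ)) 2, ← Real.rpow_mul hY0]; norm_num
  set s : ℝ := Y ^ (1 / 2 : ℝ) with hs
  have hd0 : 0 < d := by linarith
  have hc0 : 0 < c := by linarith
  have hd'3 : d' ^ 3 ≤ 64 * d ^ 3 := by
    calc d' ^ 3 ≤ (4 * d) ^ 3 := pow_le_pow_left₀ hd'0 hd' 3
      _ = 64 * d ^ 3 := by ring
  have h1 : 27648 * (P * c) ^ 2 * d ^ 6 ≤ 1728 * s * (64 * d ^ 3) :=
    h.trans (mul_le_mul_of_nonneg_left hd'3 (by positivity))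
  have h2 : (P * c) ^ 2 * d ^ 3 ≤ 4 * s := by
    have hd3 : 0 < 27648 * d ^ 3 := by positivity
    refine le_of_mul_le_mul_left ?_ hd3
    calc 27648 * d ^ 3 * ((P * c) ^ 2 * d ^ 3) = 27648 * (P * c) ^ 2 * d ^ 6 := by ring
      _ ≤ 1728 * s * (64 * d ^ 3) := h1
      _ = 27648 * d ^ 3 * (4 * s) := by ring
  have h3 : ((P * c) ^ 2 * d ^ 3) ^ 2 ≤ (4 * s) ^ 2 := pow_le_pow_left₀ (by positivity) h2 2
  have hcd : 0 < (c * d) ^ 6 := by positivity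
  have key : (P ^ 2) ^ 2 * (c ^ 4 * d ^ 6) < (363 * c) ^ 2 * (c ^ 4 * d ^ 6) := by
    calc (P ^ 2) ^ 2 * (c ^ 4 * d ^ 6) = ((P * c) ^ 2 * d ^ 3) ^ 2 := by ring
      _ ≤ (4 * s) ^ 2 := h3
      _ = 16 * Y := by rw [mul_pow, hs2]; norm_num
      _ < 32 * M := by linarith
      _ < 131072 * (c * d) ^ 6 := by linarith
      _ ≤ (363 * c) ^ 2 * (c ^ 4 * d ^ 6) := by nlinarith [hcd]
  have hpos : 0 ≤ c ^ 4 * d ^ 6 := by positivity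
  have h4 : (P ^ 2) ^ 2 < (363 * c) ^ 2 := lt_of_mul_lt_mul_right key hpos
  have hP4 : (363 * c) ^ 2 ≤ (P ^ 2) ^ 2 := pow_le_pow_left₀ (by positivity) hP 2
  linarith

/-! ## 3. The twisted Frey pair lies in the deep-regime set -/

/-- **Membership** (the invariants are the hypotheses supplied by the registered fact a1
`twistedFreyPair_facts`): for coprime positive `a ≠ b` with `(ab)² ≥ 363(a + b)`, `d ≥ 1`, the twisted pair
`x = (d²c₄, d³c₆)` with `c₄c₆ ≠ 0`, `Δ ≠ 0`, `1728 ∣ c₄³ − c₆²`, tower-free, `r'(x) = 1`,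
`c₄³ − c₆² = 27648(ab(a+b))²d⁶`, `c₄ > 0`, `c₄³ = M := (16A)³d⁶`, `(16A)³ < 4096(a+b)⁶`, `16(ab(a+b))² ≤ (16A)³`,
twist divisors dividing `4d`, lies in `cuspSetD X₀ Y ∩ DeepRegimeTw Y` whenever `N*(x) ≤ X₀` and `M ≤ Y < 2M`:
level `|c₄|³ = M`, `|Δ| = 16(ab(a+b))²d⁶ ≤ M`; tube by `thick_arith`; `r' = 1 < Y^{1/6}`. -/
theorem mem_deep_of_facts {a b d : ℕ} {x : ℤ × ℤ} {X₀ Y : ℝ} (ha : 0 < a) (hb : 0 < b) (hd : 0 < d)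
    (hx1 : x.1 ≠ 0) (hx2 : x.2 ≠ 0) (hx3 : x.1 ^ 3 ≠ x.2 ^ 2) (h1728 : (1728 : ℤ) ∣ x.1 ^ 3 - x.2 ^ 2)
    (hTF : TF x) (hsr : simpleRad x = 1)
    (hD : x.1 ^ 3 - x.2 ^ 2 = 27648 * ((a : ℤ) * b * (a + b)) ^ 2 * (d : ℤ) ^ 6) (hpos : 0 < x.1)
    (hM : x.1 ^ 3 = (16 * ((a : ℤ) ^ 2 + a * b + (b : ℤ) ^ 2)) ^ 3 * (d : ℤ) ^ 6)
    (hhi : (16 * ((a : ℤ) ^ 2 + a * b + (b : ℤ) ^ 2)) ^ 3 < 4096 * ((a : ℤ) + b) ^ 6)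
    (hsyz : 16 * ((a : ℤ) * b * (a + b)) ^ 2 ≤ (16 * ((a : ℤ) ^ 2 + a * b + (b : ℤ) ^ 2)) ^ 3)
    (htw : ∀ d' : ℕ, (d' : ℤ) ^ 2 ∣ x.1 → (d' : ℤ) ^ 3 ∣ x.2 → d' ∣ 4 * d)
    (hthick : 363 * (a + b) ≤ (a * b) ^ 2) (hNX : (Nstar x : ℝ) ≤ X₀)
    (hMY : (16 * ((a : ℝ) ^ 2 + a * b + (b : ℝ) ^ 2)) ^ 3 * (d : ℝ) ^ 6 ≤ Y)
    (hYM : Y < 2 * ((16 * ((a : ℝ) ^ 2 + a * b + (b : ℝ) ^ 2)) ^ 3 * (d : ℝ) ^ 6)) :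
    x ∈ cuspSetD X₀ Y ∧ DeepRegimeTw Y x := by
  have ha1 : (1 : ℝ) ≤ a := by exact_mod_cast ha
  have hb1 : (1 : ℝ) ≤ b := by exact_mod_cast hb
  have hd1 : (1 : ℝ) ≤ d := by exact_mod_cast hd
  set A : ℝ := (a : ℝ) ^ 2 + a * b + (b : ℝ) ^ 2 with hA
  set m : ℝ := (a : ℝ) * b * (a + b) with hm
  set M : ℝ := (16 * A) ^ 3 * (d : ℝ) ^ 6 with hMdef
  have hA3 : 3 ≤ A := by rw [hA]; nlinarith
  have hd6 : (1 : ℝ) ≤ (d : ℝ) ^ 6 := one_le_pow₀ hd1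
  have hM1 : (48 : ℝ) ^ 3 ≤ M := by
    have h1 : (48 : ℝ) ^ 3 ≤ (16 * A) ^ 3 := pow_le_pow_left₀ (by norm_num) (by linarith) 3
    calc (48 : ℝ) ^ 3 = 48 ^ 3 * 1 := by ring
      _ ≤ (16 * A) ^ 3 * (d : ℝ) ^ 6 := mul_le_mul h1 hd6 zero_le_one (by positivity)
  have hY1 : 1 < Y := by linarith
  have hY0 : 0 ≤ Y := by linarith
  have cast1 : (((|x.1| ^ 3 : ℤ)) : ℝ) = M := by
    rw [abs_of_pos hpos, hM, hMdef, hA]; push_cast; ring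
  have cast2 : (((|x.1 ^ 3 - x.2 ^ 2| : ℤ)) : ℝ) = 27648 * m ^ 2 * (d : ℝ) ^ 6 := by
    rw [hD, abs_of_nonneg (by positivity), hm]; push_cast; ring
  have hsyzR : 16 * m ^ 2 ≤ (16 * A) ^ 3 := by
    rw [hm, hA]; exact_mod_cast hsyz
  have hhiR : (16 * A) ^ 3 < 4096 * ((a : ℝ) + b) ^ 6 := by
    rw [hA]; exact_mod_cast hhi
  have hDM : 27648 * m ^ 2 * (d : ℝ) ^ 6 ≤ 1728 * M := by
    rw [hMdef]; nlinarith [hd6]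
  refine ⟨?_, ?_, ?_⟩
  · -- the dyadic cusp set
    show x.1 ≠ 0 ∧ x.2 ≠ 0 ∧ x.1 ^ 3 ≠ x.2 ^ 2 ∧ (1728 : ℤ) ∣ x.1 ^ 3 - x.2 ^ 2 ∧ TF x ∧
      ((|x.1| ^ 3 : ℤ) : ℝ) ≤ Y ∧ ((|x.1 ^ 3 - x.2 ^ 2| : ℤ) : ℝ) ≤ 1728 * Y ∧
      Y < 2 * max (((|x.1| ^ 3 : ℤ) : ℝ)) (((|x.1 ^ 3 - x.2 ^ 2| : ℤ) : ℝ) / 1728) ∧ (Nstar x : ℝ) ≤ X₀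
    refine ⟨hx1, hx2, hx3, h1728, hTF, ?_, ?_, ?_, hNX⟩
    · rw [cast1]; exact hMY
    · rw [cast2]; linarith
    · rw [cast1]
      exact lt_of_lt_of_le hYM (mul_le_mul_of_nonneg_left (le_max_left _ _) (by norm_num))
  · -- the twist-aware thick tube
    intro d' hd'1 hd'2
    have hdvd : d' ∣ 4 * d := htw d' hd'1 hd'2
    have hle : d' ≤ 4 * d := Nat.le_of_dvd (by omega) hdvd
    have hleR : (d' : ℝ) ≤ 4 * d := by exact_mod_cast hle
    have hthickR : (363 : ℝ) * ((a : ℝ) + b) ≤ ((a : ℝ) * b) ^ 2 := by exact_mod_cast hthick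
    have hM4096 : M < 4096 * (((a : ℝ) + b) * d) ^ 6 := by
      rw [hMdef]
      calc (16 * A) ^ 3 * (d : ℝ) ^ 6 < 4096 * ((a : ℝ) + b) ^ 6 * (d : ℝ) ^ 6 :=
            mul_lt_mul_of_pos_right hhiR (by positivity)
        _ = 4096 * (((a : ℝ) + b) * d) ^ 6 := by ring
    rw [cast2]
    have h := thick_arith (P := (a : ℝ) * b) (c := (a : ℝ) + b) (by linarith) hd1 (Nat.cast_nonneg d') hleR
      hthickR hY0 hYM hM4096
    exact h
  · -- the simple radical `1 < Y^{1/6}`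
    rw [hsr, Nat.cast_one]
    exact Real.one_lt_rpow hY1 (by norm_num)

/-- Registered sub-goal `twistedFreyPair_mem_deepRegimeTw` of stmt-ABC-1975 (split of the calibration a2
`abc_of_lawOn_deepRegimeTw_of_facts`, line `deep-moduli-cusp-dispersion`): membership of the twisted Frey pair in the
twist-aware deep-regime set at any window `M ≤ Y < 2M`, `N* ≤ X₀`, from the invariants of fact a1. -/
theorem twistedFreyPair_mem_deepRegimeTw : ∀ (a b d : ℕ) (x : ℤ × ℤ) (X₀ Y : ℝ), 0 < a → 0 < b → 0 < d → x.1 ≠ 0 → x.2 ≠ 0 → x.1 ^ 3 ≠ x.2 ^ 2 → (1728 : ℤ) ∣ x.1 ^ 3 - x.2 ^ 2 → TF x → simpleRad x = 1 → x.1 ^ 3 - x.2 ^ 2 = 27648 * ((a : ℤ) * b * (a + b)) ^ 2 * (d : ℤ) ^ 6 → 0 < x.1 → x.1 ^ 3 = (16 * ((a : ℤ) ^ 2 + a * b + (b : ℤ) ^ 2)) ^ 3 * (d : ℤ) ^ 6 → (16 * ((a : ℤ) ^ 2 + a * b + (b : ℤ) ^ 2)) ^ 3 < 4096 * ((a : ℤ)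 + b) ^ 6 → 16 * ((a : ℤ) * b * (a + b)) ^ 2 ≤ (16 * ((a : ℤ) ^ 2 + a * b + (b : ℤ) ^ 2)) ^ 3 → (∀ d' : ℕ, (d' : ℤ) ^ 2 ∣ x.1 → (d' : ℤ) ^ 3 ∣ x.2 → d' ∣ 4 * d) → 363 * (a + b) ≤ (a * b) ^ 2 → (Nstar x : ℝ) ≤ X₀ → (16 * ((a : ℝ) ^ 2 + a * b + (b : ℝ) ^ 2)) ^ 3 * (d : ℝ) ^ 6 ≤ Y → Y < 2 * ((16 * ((a : ℝ) ^ 2 + a * b + (b : ℝ) ^ 2)) ^ 3 * (d : ℝ) ^ 6) → x ∈ cuspSetD X₀ Y ∧ DeepRegimeTw Y x :=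
  fun _ _ _ _ _ _ ha hb hd hx1 hx2 hx3 h1728 hTF hsr hD hpos hM hhi hsyz htw hthick hNX hMY hYM =>
    mem_deep_of_facts ha hb hd hx1 hx2 hx3 h1728 hTF hsr hD hpos hM hhi hsyz htw hthick hNX hMY hYM

end Summit.ABC.ABC.Theorems.SharpModerateLaw.CuspDispersion

end
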